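import Literature.MathematicalPhysics.QuantumManyBody.PeriodicBoseGasCoulombFourier
import HarnessLib

/-!
# Gaussian subordination of the Riesz kernels `|x|^{-α}` on `ℝ³` and the polarised Gaussian identity

Analysis/Potential support file (everything proved; no definitions, no named facts) for the
Fourier representation of the Riesz pairing `∫∫ u(x)|x−y|^{-α}v(y)`
(`RieszKernelFourierPairing.lean`), following the Gaussian-subordination method of the tree's
`Literature.MathematicalPhysics.QuantumManyBody.BoseGas.lintegral_normSq_fourier_div_eq`
(the Coulomb case `α = 1`; Stein, *Singular Integrals*, Ch. III §2.1 and Ch. V §1.1):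

* `integral_heatSymbol_mul_fourier_mul_conj_fourier` — the polarised Gaussian identity on a
  finite-dimensional inner product space: for real `u, w ∈ L¹` and `s > 0`,
  `∫ e^{-4π²s|p|²} û(p) conj(ŵ(p)) dp = ∬ u(x) w(y) G_s(x − y) dx dy` (`G_s` the heat kernel);
* `integral_Ioi_rpow_mul_exp_neg_div` — `∫₀^∞ s^{b-1} e^{-a/s} ds = a^b Γ(−b)` (`a > 0 > b`);
* `integral_Ioi_rpow_mul_heatKernel` — on `ℝ³`, for `0 < α` and `z ≠ 0`,
  `∫₀^∞ s^{(1−α)/2} G_s(z) ds = (4π)^{-3/2} 4^{α/2} Γ(α/2) · |z|^{-α}` (with integrability);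
* `integral_Ioi_rpow_mul_heatSymbol` — for `α < 3` and `p ≠ 0`,
  `∫₀^∞ s^{(1−α)/2} e^{-4π²s|p|²} ds = Γ((3−α)/2) (2π)^{α−3} |p|^{α−3}` (with integrability).

References: E. M. Stein, *Singular Integrals and Differentiability Properties of Functions*
(1970), Ch. III §2.1, Ch. V §1.1 Lemma 1; E. H. Lieb, M. Loss, *Analysis* (2001), Thm. 5.9.
-/

noncomputable section

open MeasureTheory Set Filter
open scoped FourierTransform ComplexConjugate RealInnerProductSpace Real Topology
open Literature.Analysis.UnboundedOperators
open Literature.MathematicalPhysics.QuantumManyBody.BoseGas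

namespace Literature.Analysis.Potential

/-! ### The polarised Gaussian identity -/

section Gaussian

variable {V : Type*} [NormedAddCommGroup V] [InnerProductSpace ℝ V] [FiniteDimensional ℝ V]
  [MeasurableSpace V] [BorelSpace V]

omit [FiniteDimensional ℝ V] [MeasurableSpace V] [BorelSpace V] in
/-- The heat kernel is even. [folklore] -/
theorem heatKernel_neg_arg (t : ℝ) (x : V) : heatKernel t (-x) = heatKernel t x := by
  unfold heatKernel
  rw [norm_neg]

/-- **Polarised Gaussian identity** `∫ e^{-4π²s|p|²} û(p) conj(ŵ(p)) dp = ∬ u(x) w(y) G_s(x−y) dx dy`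
for real `u, w ∈ L¹(V)` and `s > 0` (Mathlib's convention `û(p) = ∫ e^{-2πi⟨x,p⟩}u`; `G_s` the
Gauss–Weierstrass kernel, `𝓕G_s = e^{-4π²s|·|²}`): `û conj(ŵ) = 𝓕u · 𝓕⁻w` is a double integral
of `u(x)w(y)e^{2πi⟨y−x,p⟩}`, absolutely convergent against the Gaussian, and Fubini leaves
`𝓕⁻(e^{-4π²s|·|²})(y − x) = G_s(x − y)` (the diagonal case `u = w` is the tree's
`BoseGas.integral_heatSymbol_mul_normSq_fourier`). [folklore] -/
theorem integral_heatSymbol_mul_fourier_mul_conj_fourier {u w : V → ℝ} (hum : Measurable u)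
    (hwm : Measurable w) (hu : Integrable u) (hw : Integrable w) {s : ℝ} (hs : 0 < s) :
    ∫ p, (heatSymbol s p : ℂ) * (𝓕 (fun x => (u x : ℂ)) p * conj (𝓕 (fun x => (w x : ℂ)) p)) =
      ((∫ x, ∫ y, u x * w y * heatKernel s (x - y) : ℝ) : ℂ) := by
  set U : V → ℂ := fun x => (u x : ℂ) with hUdef
  set W : V → ℂ := fun x => (w x : ℂ) with hWdef
  have hUm : Measurable U := Complex.measurable_ofReal.comp hum
  have hWm : Measurable W := Complex.measurable_ofReal.comp hwm
  have hsym := integrable_heatSymbol (V := V) hs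
  have hGb : ∀ z : V, |heatKernel s z| ≤ (4 * π * s) ^ (-(Module.finrank ℝ V : ℝ) / 2) := fun z => by
    rw [abs_of_pos (heatKernel_pos hs z)]
    exact heatKernel_le hs z
  -- the integrand of the triple integral
  set Φ : V → V × V → ℂ := fun p z =>
    (heatSymbol s p : ℂ) * ((𝐞 (-⟪z.1, p⟫) : ℂ) * U z.1 * ((𝐞 ⟪z.2, p⟫ : ℂ) * W z.2)) with hΦdef
  have hΦn : ∀ p z, ‖Φ p z‖ = heatSymbol s p * (‖u z.1‖ * ‖w z.2‖) := by
    intro p z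
    simp only [hΦdef, hUdef, hWdef, norm_mul, Complex.norm_real, Circle.norm_coe, one_mul,
      Real.norm_eq_abs, abs_of_pos (heatSymbol_pos s p)]
  have hΦm : Measurable (Function.uncurry Φ) := by
    have h1 : Measurable fun q : V × (V × V) => (heatSymbol s q.1 : ℂ) :=
      Complex.measurable_ofReal.comp ((by unfold heatSymbol; fun_prop :
        Continuous fun p : V => heatSymbol s p).measurable.comp measurable_fst)
    have h2 : Measurable fun q : V × (V × V) => (𝐞 (-⟪q.2.1, q.1⟫) : ℂ) :=
      (continuous_subtype_val.comp (Real.continuous_fourierChar.comp (by fun_prop))).measurable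
    have h3 : Measurable fun q : V × (V × V) => (𝐞 ⟪q.2.2, q.1⟫ : ℂ) :=
      (continuous_subtype_val.comp (Real.continuous_fourierChar.comp (by fun_prop))).measurable
    have h4 : Measurable fun q : V × (V × V) => U q.2.1 := hUm.comp (measurable_fst.comp measurable_snd)
    have h5 : Measurable fun q : V × (V × V) => W q.2.2 := hWm.comp (measurable_snd.comp measurable_snd)
    exact h1.mul ((h2.mul h4).mul (h3.mul h5))
  have hΦi : Integrable (Function.uncurry Φ)
      ((volume : Measure V).prod ((volume : Measure V).prod volume)) := by
    have hb : Integrable (fun q : V × (V × V) => heatSymbol s q.1 * (‖u q.2.1‖ * ‖w q.2.2‖))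
        ((volume : Measure V).prod ((volume : Measure V).prod volume)) :=
      hsym.mul_prod (hu.norm.mul_prod hw.norm)
    refine hb.mono' hΦm.aestronglyMeasurable (Eventually.of_forall fun q => ?_)
    rw [Function.uncurry_apply_pair] at *
    exact (hΦn q.1 q.2).le
  -- Step 1: the left-hand side as `∫_p ∫_z Φ`
  have hL : ∫ p, (heatSymbol s p : ℂ) * (𝓕 U p * conj (𝓕 W p)) =
      ∫ p, ∫ z, Φ p z ∂((volume : Measure V).prod volume) := by
    refine integral_congr_ae (Eventually.of_forall fun p => ?_)
    simp only
    rw [conj_fourier_ofReal, Real.fourierInv_eq, Real.fourier_eq, ← integral_prod_mul,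
      ← integral_const_mul]
    refine integral_congr_ae (Eventually.of_forall fun z => ?_)
    simp only [hΦdef, hUdef, hWdef, Circle.smul_def, smul_eq_mul]
  -- Step 2: Fubini
  have hswap : ∫ p, ∫ z, Φ p z ∂((volume : Measure V).prod volume) =
      ∫ z, ∫ p, Φ p z ∂(volume : Measure V) ∂((volume : Measure V).prod volume) :=
    integral_integral_swap hΦi
  -- Step 3: the inner `p`-integral is `u(x) w(y) 𝓕⁻(ĥ)(y - x) = u(x) w(y) G_s(x - y)`
  have hinner : ∀ z : V × V, ∫ p, Φ p z = U z.1 * W z.2 * (heatKernel s (z.1 - z.2) : ℂ) := by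
    intro z
    have h1 : ∀ p : V, Φ p z =
        U z.1 * W z.2 * ((𝐞 ⟪p, z.2 - z.1⟫ : Circle) • (heatSymbol s p : ℂ)) := by
      intro p
      simp only [hΦdef, Circle.smul_def, smul_eq_mul]
      have : (𝐞 (-⟪z.1, p⟫) : ℂ) * (𝐞 ⟪z.2, p⟫ : ℂ) = (𝐞 ⟪p, z.2 - z.1⟫ : ℂ) := by
        rw [← Circle.coe_mul, ← AddChar.map_add_eq_mul, inner_sub_right, real_inner_comm p z.1,
          real_inner_comm p z.2]
        congr 2
        ring
      rw [← this]
      ring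
    simp_rw [h1]
    rw [integral_const_mul, ← Real.fourierInv_eq, fourierInv_heatSymbol hs]
    simp only
    rw [← neg_sub z.1 z.2, heatKernel_neg_arg]
  simp_rw [hinner] at hswap
  -- Step 4: back to an iterated real integral
  have hprod : Integrable (fun z : V × V => U z.1 * W z.2 * (heatKernel s (z.1 - z.2) : ℂ))
      ((volume : Measure V).prod volume) := by
    have hb : Integrable (fun z : V × V =>
        ‖u z.1‖ * (‖w z.2‖ * (4 * π * s) ^ (-(Module.finrank ℝ V : ℝ) / 2)))
        ((volume : Measure V).prod volume) := hu.norm.mul_prod (hw.norm.mul_const _)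
    refine hb.mono' ?_ (Eventually.of_forall fun z => ?_)
    · exact ((hUm.comp measurable_fst).mul (hWm.comp measurable_snd)).mul
        (Complex.measurable_ofReal.comp ((continuous_heatKernel s).measurable.comp
          (measurable_fst.sub measurable_snd))) |>.aestronglyMeasurable
    · simp only [norm_mul, hUdef, hWdef, Complex.norm_real, Real.norm_eq_abs]
      rw [mul_assoc]
      gcongr
      exact hGb _
  have hR : ∫ z, U z.1 * W z.2 * (heatKernel s (z.1 - z.2) : ℂ) ∂((volume : Measure V).prod volume) =
      ((∫ x, ∫ y, u x * w y * heatKernel s (x - y) : ℝ) : ℂ) := by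
    rw [integral_prod _ hprod, ← integral_complex_ofReal]
    refine integral_congr_ae (Eventually.of_forall fun x => ?_)
    simp only
    rw [← integral_complex_ofReal]
    refine integral_congr_ae (Eventually.of_forall fun y => ?_)
    simp only [hUdef, hWdef]
    push_cast
    ring
  exact hL.trans (hswap.trans hR)

end Gaussian

/-! ### Weighted subordination integrals -/

/-- `∫₀^∞ s^{b-1} e^{-a/s} ds = a^b Γ(−b)` for `a > 0`, `b < 0` (substitution `s = 1/y` and the
Gamma integral `∫₀^∞ y^{-b-1} e^{-ay} dy = a^{b} Γ(−b)`). [folklore] -/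
theorem integral_Ioi_rpow_mul_exp_neg_div {a b : ℝ} (ha : 0 < a) (hb : b < 0) :
    ∫ s in Ioi (0 : ℝ), s ^ (b - 1) * Real.exp (-(a / s)) = a ^ b * Real.Gamma (-b) := by
  have h := integral_comp_rpow_Ioi (fun y : ℝ => y ^ (-b - 1) * Real.exp (-(a * y))) (p := -1)
    (by norm_num)
  rw [Real.integral_rpow_mul_exp_neg_mul_Ioi (by linarith : 0 < -b) ha] at h
  have hev : ∀ x ∈ Ioi (0 : ℝ), (|(-1 : ℝ)| * x ^ ((-1 : ℝ) - 1)) •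
      ((x ^ (-1 : ℝ)) ^ (-b - 1) * Real.exp (-(a * x ^ (-1 : ℝ)))) =
      x ^ (b - 1) * Real.exp (-(a / x)) := by
    intro x hx
    have hx0 : 0 < x := hx
    rw [smul_eq_mul, ← Real.rpow_mul hx0.le, Real.rpow_neg_one, ← div_eq_mul_inv, abs_neg, abs_one,
      one_mul, ← mul_assoc, ← Real.rpow_add hx0]
    norm_num
    congr 1
    ring
  rw [setIntegral_congr_fun measurableSet_Ioi hev] at h
  rw [h, one_div, Real.inv_rpow ha.le, Real.rpow_neg ha.le, inv_inv]

/-- **Weighted subordination of the Riesz kernel to the heat kernel on `ℝ³`**: for `0 < α` and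
`z ≠ 0`, `s ↦ s^{(1−α)/2} G_s(z)` is integrable on `(0, ∞)` and
`∫₀^∞ s^{(1−α)/2} G_s(z) ds = (4π)^{-3/2} 4^{α/2} Γ(α/2) |z|^{-α}` (substitution `s = |z|²/(4y)`).
[folklore] -/
theorem integral_Ioi_rpow_mul_heatKernel {α : ℝ} (hα : 0 < α) {z : EuclideanSpace ℝ (Fin 3)}
    (hz : z ≠ 0) :
    IntegrableOn (fun s : ℝ => s ^ ((1 - α) / 2) * heatKernel s z) (Ioi 0) ∧
      ∫ s in Ioi (0 : ℝ), s ^ ((1 - α) / 2) * heatKernel s z =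
        (4 * π) ^ (-(3 / 2 : ℝ)) * (4 : ℝ) ^ (α / 2) * Real.Gamma (α / 2) * ‖z‖ ^ (-α) := by
  have hr : 0 < ‖z‖ := norm_pos_iff.2 hz
  have ha : 0 < ‖z‖ ^ 2 / 4 := by positivity
  -- the integrand for `s > 0`
  have hev : ∀ s ∈ Ioi (0 : ℝ), s ^ ((1 - α) / 2) * heatKernel s z =
      (4 * π) ^ (-(3 / 2 : ℝ)) * (s ^ ((-(α / 2)) - 1) * Real.exp (-((‖z‖ ^ 2 / 4) / s))) := by
    intro s hs
    have hs0 : 0 < s := hs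
    rw [heatKernel_three, Real.mul_rpow (by positivity) hs0.le]
    have e1 : -‖z‖ ^ 2 / (4 * s) = -((‖z‖ ^ 2 / 4) / s) := by field_simp
    have e2 : s ^ ((1 - α) / 2) * s ^ (-(3 / 2 : ℝ)) = s ^ ((-(α / 2)) - 1) := by
      rw [← Real.rpow_add hs0]; congr 1; ring
    rw [e1, ← e2]
    ring
  have hval : ∫ s in Ioi (0 : ℝ), s ^ ((1 - α) / 2) * heatKernel s z =
      (4 * π) ^ (-(3 / 2 : ℝ)) * (4 : ℝ) ^ (α / 2) * Real.Gamma (α / 2) * ‖z‖ ^ (-α) := by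
    rw [setIntegral_congr_fun measurableSet_Ioi hev, integral_const_mul,
      integral_Ioi_rpow_mul_exp_neg_div ha (by linarith : -(α / 2) < 0), neg_neg,
      Real.div_rpow (sq_nonneg _) (by norm_num : (0 : ℝ) ≤ 4),
      show (‖z‖ ^ 2 : ℝ) = ‖z‖ ^ (2 : ℝ) by norm_cast, ← Real.rpow_mul hr.le,
      Real.rpow_neg (by norm_num : (0 : ℝ) ≤ 4), div_inv_eq_mul]
    have : (2 : ℝ) * -(α / 2) = -α := by ring
    rw [this]
    ring
  have hpos : 0 < (4 * π) ^ (-(3 / 2 : ℝ)) * (4 : ℝ) ^ (α / 2) * Real.Gamma (α / 2) * ‖z‖ ^ (-α) := by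
    have := Real.Gamma_pos_of_pos (by linarith : 0 < α / 2)
    positivity
  refine ⟨?_, hval⟩
  by_contra h
  rw [IntegrableOn] at h
  rw [integral_undef h] at hval
  exact hpos.ne hval

/-- **Weighted subordination on the Fourier side**: for `α < 3` and `p ≠ 0`,
`s ↦ s^{(1−α)/2} e^{-4π²s|p|²}` is integrable on `(0, ∞)` and
`∫₀^∞ s^{(1−α)/2} e^{-4π²s|p|²} ds = Γ((3−α)/2) (2π)^{α−3} |p|^{α−3}`. [folklore] -/
theorem integral_Ioi_rpow_mul_heatSymbol {V : Type*} [NormedAddCommGroup V] {α : ℝ} (hα : α < 3)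
    {p : V} (hp : p ≠ 0) :
    IntegrableOn (fun s : ℝ => s ^ ((1 - α) / 2) * heatSymbol s p) (Ioi 0) ∧
      ∫ s in Ioi (0 : ℝ), s ^ ((1 - α) / 2) * heatSymbol s p =
        Real.Gamma ((3 - α) / 2) * (2 * π) ^ (α - 3) * ‖p‖ ^ (α - 3) := by
  have hnp : 0 < ‖p‖ := norm_pos_iff.2 hp
  have hrpos : 0 < (2 * π) ^ 2 * ‖p‖ ^ 2 := by positivity
  have hev : ∀ s : ℝ, s ^ ((1 - α) / 2) * heatSymbol s p =
      s ^ ((3 - α) / 2 - 1) * Real.exp (-((2 * π) ^ 2 * ‖p‖ ^ 2 * s)) := by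
    intro s
    simp only [heatSymbol]
    congr 1
    · congr 1; ring
    · congr 1; ring
  have hval : ∫ s in Ioi (0 : ℝ), s ^ ((1 - α) / 2) * heatSymbol s p =
      Real.Gamma ((3 - α) / 2) * (2 * π) ^ (α - 3) * ‖p‖ ^ (α - 3) := by
    simp_rw [hev]
    rw [Real.integral_rpow_mul_exp_neg_mul_Ioi (by linarith : 0 < (3 - α) / 2) hrpos, one_div,
      Real.inv_rpow hrpos.le, ← Real.rpow_neg hrpos.le,
      Real.mul_rpow (by positivity) (by positivity),
      show ((2 * π) ^ 2 : ℝ) = (2 * π) ^ (2 : ℝ) by norm_cast,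
      show (‖p‖ ^ 2 : ℝ) = ‖p‖ ^ (2 : ℝ) by norm_cast,
      ← Real.rpow_mul (by positivity), ← Real.rpow_mul hnp.le]
    have : (2 : ℝ) * -((3 - α) / 2) = α - 3 := by ring
    rw [this]
    ring
  have hpos : 0 < Real.Gamma ((3 - α) / 2) * (2 * π) ^ (α - 3) * ‖p‖ ^ (α - 3) := by
    have := Real.Gamma_pos_of_pos (by linarith : 0 < (3 - α) / 2)
    positivity
  refine ⟨?_, hval⟩
  by_contra h
  rw [IntegrableOn] at h
  rw [integral_undef h] at hval
  exact hpos.ne hval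

end Literature.Analysis.Potential

end
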